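import Summits.ABC.StewartYu.PadicTwistAssembly
import Summits.ABC.StewartYu.PadicTwistSiegel
import Summits.ABC.StewartYu.PadicW80SizesLC
import Summits.ABC.StewartYu.PadicW80BudgetsL
import Summits.ABC.StewartYu.PadicW80NumericLB
import Summits.ABC.StewartYu.PadicW80ParLF
import Summits.ABC.StewartYu.PadicW80ParLEnvelope
import Summits.ABC.StewartYu.DescentSizesQ
import HarnessLib

/-!
# Cell abc-stewartyu, WP-Y3 (xii): the parameter pack of the twisted machine at p1's
# `(log p)`-normalised record, ALL inputs discharged; the core bound; the engine

`Summits/ABC/StewartYu/PadicTwistPack.lean` — cell `abc-stewartyu` (seat p2; crux stmt-ABC-19485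
`W80ThreeModFour`; one structure-valued `def` + theorems, no named fact).  TWIN of Part 1 of p3's
`PadicPrincipalCoreST86TheoremA.lean` (`paramPackOf`) and of p3's junction files
`PadicCW77Sizes.lean` / `PadicCW77Junctions.lean` for `S : TwistSetup p`, on p1's record
`PadicW80ParL S.d` (`PadicW80ParL{,A–F,Envelope}`, `PadicW80BudgetsL`, `PadicW80NumericL{,B}`,
`PadicW80SizesL{,B,C}`) instantiated with `ℓ = log p` and the class price `Mcl = G`:

* `kSizes_of_hyp`, `hSizesHalf_of_hyp`, `siegel_of_hyp` (Siegel on a class: `siegel_class` + p1's count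
  `padic_siegel_count_real` with `Mcl = G`), `endgame_of_params` (`endgame_of_numbers` + p1's
  `endgame_numbers`), `sizeHyp_of_logHeight`, `PintP`;
* **`paramPackOf : S.ParamPack P.Uℓ`** — every field of p2's `TwistSetup.ParamPack` discharged;
  `norm_Λ₀_gt : e^{−U} < ‖Λ₀‖_p`.

## References
* [Yu1990] K. Yu, Compositio Math. 74 (1990), §2 Proposition 2.1 and (2.8)–(2.13), (2.30)–(2.33).
* [Waldschmidt1980] M. Waldschmidt, Acta Arith. 37 (1980), §§3.2–3.5.
-/

noncomputable section

open Finset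
open Literature.NumberTheory.Transcendental
open Literature.NumberTheory.Transcendental.CW77 (heightProd hgt)
open Literature.NumberTheory.Transcendental.CW77.Setup (Idx Tau tauNorm tauSet)

namespace Summit.ABC.StewartYu

namespace TwistSetup

open PadicW80Par (cLp')

variable {p : ℕ} [Fact p.Prime] (S : TwistSetup p) {h Lb : ℕ}

/-! ### Absolute values and integrality of the terms -/

/-- `|qTerm|` of `S.toQ` is `|qTerm♭|` of the flattening (real casts). [folklore] -/
theorem abs_cast_qTerm_eq_flat (J₀ J : ℕ) (u : Idx S.d h Lb) (τ : Tau S.d) (s : ℕ) :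
    |(S.toQ.qTerm J₀ J u τ s : ℝ)| = |(S.toQ.flat.qTerm J₀ J u τ s : ℝ)| := by
  rw [← Rat.cast_abs, ← Rat.cast_abs, S.toQ.abs_qTerm]

/-- `|rHalf|` of `S.toQ` is `|rHalf♭|` (real casts). [folklore] -/
theorem abs_cast_rHalf_eq_flat (J₀ J : ℕ) (τ : Tau S.d) (u : Idx S.d h Lb) (s : ℕ) :
    |(S.toQ.rHalf J₀ J u τ s : ℝ)| = |(S.toQ.flat.rHalf J₀ J u τ s : ℝ)| := by
  rw [← Rat.cast_abs, ← Rat.cast_abs, S.toQ.abs_rHalf]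

/-- `DclearJ♭(s,τ) · qTerm_J(u,τ,s) ∈ ℤ` on the box of level `J`. [folklore] -/
theorem exists_int_flatDclearJ_mul_qTerm (J₀ J : ℕ) {L : Fin S.d → ℕ} {Lθ : ℕ} {u : Idx S.d h Lb}
    (hu : u ∈ S.toQ.flat.box (h := h) (Lb := Lb) L Lθ J) (τ : Tau S.d) (s : ℕ) :
    ∃ z : ℤ, ((S.toQ.flat.DclearJ (h := h) J₀ J L Lθ s τ : ℕ) : ℚ) * S.toQ.qTerm J₀ J u τ s = z := by
  obtain ⟨z, hz⟩ := S.toQ.flat.exists_int_DclearJ_mul_qTerm J₀ J (u := u) hu τ s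
  have habs : |((S.toQ.flat.DclearJ (h := h) J₀ J L Lθ s τ : ℕ) : ℚ) * S.toQ.qTerm J₀ J u τ s| = |(z : ℚ)| := by
    rw [← hz, abs_mul, abs_mul, S.toQ.abs_qTerm]
  rcases abs_eq_abs.mp habs with h1 | h1
  · exact ⟨z, h1⟩
  · exact ⟨-z, by rw [h1]; push_cast; ring⟩

/-- `DclearJ♭(s,τ) · coreSum_J(τ,s) ∈ ℤ`. [folklore] -/
theorem exists_int_flatDclearJ_mul_coreSum (J₀ J : ℕ) (L : Fin S.d → ℕ) (Lθ : ℕ)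
    (pv : Idx S.d h Lb → ℤ) (τ : Tau S.d) (s : ℕ) :
    ∃ m : ℤ, ((S.toQ.flat.DclearJ (h := h) J₀ J L Lθ s τ : ℕ) : ℚ) *
      S.toQ.coreSum J₀ J (S.toQ.flat.box (h := h) (Lb := Lb) L Lθ J) pv τ s = m := by
  classical
  have hint : ∀ u ∈ S.toQ.flat.box (h := h) (Lb := Lb) L Lθ J, ∃ z : ℤ,
      ((S.toQ.flat.DclearJ (h := h) J₀ J L Lθ s τ : ℕ) : ℚ) * S.toQ.qTerm J₀ J u τ s = z :=
    fun u hu => S.exists_int_flatDclearJ_mul_qTerm J₀ J hu τ s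
  choose! z hz using hint
  refine ⟨∑ u ∈ S.toQ.flat.box (h := h) (Lb := Lb) L Lθ J, pv u * z u, ?_⟩
  unfold SetupQ.coreSum
  rw [mul_sum]
  push_cast
  refine sum_congr rfl fun u hu => ?_
  rw [← hz u hu]; ring

/-! ### The height link from the hypotheses of the core bound -/

/-- **The height link of the flattening** from `h(αⱼ) ≤ Vⱼ`, `h(θ) ≤ V_θ`, `log max(3,|bⱼ|) ≤ W`,
`log max(3,|b_θ|) ≤ W`. [folklore] -/
theorem sizeHyp_of_logHeight {V : Fin S.d → ℝ} {Vθ W : ℝ} (hV : ∀ j, Height.logHeight₁ (S.α j) ≤ V j)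
    (hW : ∀ j, Real.log (max 3 (|S.b j| : ℝ)) ≤ W) (hVθ : Height.logHeight₁ S.θ ≤ Vθ)
    (hWθ : Real.log (max 3 (|S.bθ| : ℝ)) ≤ W) : S.toQ.flat.SizeHyp V Vθ W := by
  have hexp : ∀ z : ℤ, Real.log (max 3 (|z| : ℝ)) ≤ W → |(z : ℝ)| ≤ Real.exp W := by
    intro z hz
    have h3 : (0 : ℝ) < max 3 (|z| : ℝ) := lt_max_of_lt_left (by norm_num)
    have := Real.exp_le_exp.mpr hz
    rw [Real.exp_log h3] at this
    exact (le_max_right _ _).trans this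
  have hHabs : ∀ q : ℚ, Real.log (hgt |q|) = Height.logHeight₁ q := fun q => by
    rw [SetupQ.hgt_abs, CW77.log_hgt_eq_logHeight₁]
  have hl : ∀ q : ℚ, q ≠ 0 → |Real.log ((|q| : ℚ) : ℝ)| ≤ Height.logHeight₁ q := fun q hq => by
    rw [Rat.cast_abs, ← CW77.log_hgt_eq_logHeight₁]; exact SetupQ.abs_log_abs_le_log_hgt hq
  exact
    { hH := fun j => by
        show Real.log (hgt |S.α j|) ≤ V j
        rw [hHabs]; exact hV j
      hl := fun j => by
        show |Real.log ((|S.α j| : ℚ) : ℝ)| ≤ V j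
        exact (hl _ (S.α_ne j)).trans (hV j)
      hHθ := by
        show Real.log (hgt |S.θ|) ≤ Vθ
        rw [hHabs]; exact hVθ
      hlθ := by
        show |Real.log ((|S.θ| : ℚ) : ℝ)| ≤ Vθ
        exact (hl _ S.θ_ne).trans hVθ
      hb := fun j => hexp _ (hW j)
      hbθ := hexp _ hWθ }

/-! ### The junctions at p1's record -/

variable {S}
variable {P : PadicW80ParL S.d} (hy : S.toQ.flat.SizeHyp P.V P.Vθ P.W)
include hy

omit hy in
/-- `4 · (2^{k+J} S₀ / 2) = 2^{k+1+J} S₀` at the record (`S₀` is even). [folklore] -/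
theorem four_mul_kpts_rec {d : ℕ} (P : PadicW80ParL d) (J k : ℕ) :
    4 * (2 ^ (k + J) * P.S₀ℓ / 2) = 2 ^ (k + 1 + J) * P.S₀ℓ := by
  obtain ⟨m, hm⟩ := P.even_S₀
  rw [hm, ← two_mul, show 2 ^ (k + J) * (2 * m) = 2 ^ (k + J) * m * 2 by ring,
    Nat.mul_div_cancel _ two_pos]
  ring

/-- **The archimedean sizes of the inner steps in closed form** at the record. [folklore] -/
theorem kSizes_of_hyp (t : ℕ) {Pint : ℤ} (hPint : (Pint : ℝ) ≤ P.PrVℓ) {J : ℕ} (hJ : J < P.J₀ℓ)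
    {pv : Idx S.d P.hparℓ P.Lbℓ → ℤ} (inv : S.Inv P.J₀ℓ P.Lℓ P.Lθℓ P.S₀ℓ P.Tℓ Pint J pv) :
    S.KSizes P.J₀ℓ J P.Lℓ P.Lθℓ P.S₀ℓ P.Tℓ t pv P.DmaxKℓ P.MmaxKℓ := by
  classical
  intro k hk τ hτ s₁ hs₁ _hodd
  have hPr : (0 : ℝ) ≤ P.PrVℓ := by linarith [P.one_le_PrVp]
  have hτT : tauNorm τ ≤ P.Tℓ := by have := Nat.div_le_self P.Tℓ (2 ^ J); omega
  have hs4 : s₁ < 2 ^ (k + 1 + J) * P.S₀ℓ := by rw [← four_mul_kpts_rec P J k]; exact hs₁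
  have hB0 : 0 ≤ P.DmaxKℓ k := (P.DmaxK_pos k).le
  refine ⟨S.toQ.flat.DclearJ (h := P.hparℓ) P.J₀ℓ J P.Lℓ P.Lθℓ s₁ τ, S.toQ.flat.DclearJ_pos _ _ _ _ _ _,
    ?_, S.exists_int_flatDclearJ_mul_coreSum P.J₀ℓ J P.Lℓ P.Lθℓ pv τ s₁, ?_⟩
  · have := hy.DclearJ_le_pℓ hJ.le hk.le hτT hs4
    unfold PadicW80ParL.DmaxKℓ PadicW80ParL.Efacℓ; exact this
  · have hterm : ∀ u ∈ S.toQ.flat.box (h := P.hparℓ) (Lb := P.Lbℓ) P.Lℓ P.Lθℓ J,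
        |(pv u : ℝ)| * |(S.toQ.qTerm P.J₀ℓ J u τ s₁ : ℝ)| ≤ P.PrVℓ * P.DmaxKℓ k := by
      intro u hu
      have hq : |(S.toQ.qTerm P.J₀ℓ J u τ s₁ : ℝ)| ≤ P.DmaxKℓ k := by
        rw [S.abs_cast_qTerm_eq_flat]
        have := hy.abs_qTerm_le_pℓ hJ.le hk.le (u := u) hu hτT hs4
        unfold PadicW80ParL.DmaxKℓ PadicW80ParL.Efacℓ; exact this
      have hp : |(pv u : ℝ)| ≤ P.PrVℓ := le_trans (by exact_mod_cast inv.inv.bound u) hPint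
      exact mul_le_mul hp hq (abs_nonneg _) hPr
    have hcard : ((S.toQ.flat.box (h := P.hparℓ) (Lb := P.Lbℓ) P.Lℓ P.Lθℓ J).card : ℝ) ≤ P.𝔅ℓ :=
      S.toQ.flat.card_box_le_𝔅_pℓ P J
    show |((S.toQ.coreSum P.J₀ℓ J _ pv τ s₁ : ℚ) : ℝ)| ≤ P.MmaxKℓ k
    unfold SetupQ.coreSum PadicW80ParL.MmaxKℓ
    push_cast
    calc |∑ u ∈ S.toQ.flat.box (h := P.hparℓ) (Lb := P.Lbℓ) P.Lℓ P.Lθℓ J,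
          (pv u : ℝ) * (S.toQ.qTerm P.J₀ℓ J u τ s₁ : ℝ)|
        ≤ ∑ u ∈ S.toQ.flat.box (h := P.hparℓ) (Lb := P.Lbℓ) P.Lℓ P.Lθℓ J,
          |(pv u : ℝ) * (S.toQ.qTerm P.J₀ℓ J u τ s₁ : ℝ)| := abs_sum_le_sum_abs _ _
      _ ≤ ∑ u ∈ S.toQ.flat.box (h := P.hparℓ) (Lb := P.Lbℓ) P.Lℓ P.Lθℓ J, P.PrVℓ * P.DmaxKℓ k :=
          sum_le_sum fun u hu => by rw [abs_mul]; exact hterm u hu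
      _ = (S.toQ.flat.box (h := P.hparℓ) (Lb := P.Lbℓ) P.Lℓ P.Lθℓ J).card * (P.PrVℓ * P.DmaxKℓ k) := by
          rw [sum_const, nsmul_eq_mul]
      _ ≤ P.𝔅ℓ * (P.PrVℓ * P.DmaxKℓ k) := mul_le_mul_of_nonneg_right hcard (mul_nonneg hPr hB0)
      _ = P.𝔅ℓ * P.PrVℓ * P.DmaxKℓ k := by ring

/-- **The archimedean sizes at the half points in closed form**: `Dhalf♭ ≤ DmaxH` and
`∑_{T'}|classVec(T')| ≤ MmaxH`. [folklore] -/
theorem hSizesHalf_of_hyp {Pint : ℤ} (hPint : (Pint : ℝ) ≤ P.PrVℓ) {J : ℕ} (hJ : J < P.J₀ℓ) :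
    S.HSizesHalf (h := P.hparℓ) (Lb := P.Lbℓ) P.J₀ℓ J P.Lℓ P.Lθℓ P.S₀ℓ P.Tℓ Pint P.DmaxHℓ P.MmaxHℓ := by
  refine ⟨P.one_le_MmaxHp, ?_⟩
  intro pv inv s hs _hodd τ hτ
  have hPr : (0 : ℝ) ≤ P.PrVℓ := by linarith [P.one_le_PrVp]
  have hτT : tauNorm τ ≤ P.Tℓ := by have := Nat.div_le_self P.Tℓ (2 ^ (J + 1)); omega
  refine ⟨?_, ?_⟩
  · have := hy.Dhalf_le_pℓ hJ hτT hs
    unfold PadicW80ParL.DmaxHℓ PadicW80ParL.Efacℓ; exact this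
  · have hcard : ((S.toQ.flat.box (h := P.hparℓ) (Lb := P.Lbℓ) P.Lℓ P.Lθℓ J).card : ℝ) ≤ P.𝔅ℓ :=
      S.toQ.flat.card_box_le_𝔅_pℓ P J
    have key := S.toQ.sum_abs_classVec_le_card P.J₀ℓ J
      (S.toQ.flat.box (h := P.hparℓ) (Lb := P.Lbℓ) P.Lℓ P.Lθℓ J) pv τ s (Rmax := P.DmaxHℓ) hPr
      (fun u _ => le_trans (by exact_mod_cast inv.inv.bound u) hPint)
      (fun u hu => by
        rw [S.abs_cast_rHalf_eq_flat]
        have := hy.abs_rHalf_le_pℓ hJ hu hτT hs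
        unfold PadicW80ParL.DmaxHℓ PadicW80ParL.Efacℓ; exact this)
    refine key.trans ?_
    have hR0 : (0 : ℝ) ≤ P.DmaxHℓ := by linarith [P.one_le_DmaxHp]
    unfold PadicW80ParL.MmaxHℓ
    exact mul_le_mul_of_nonneg_right (mul_le_mul_of_nonneg_right hcard hPr) hR0

/-- **Siegel's lemma on a class in closed form** at the record with class price `Mcl = G`:
integers `pv(u)` of level `0` on one class, `|pv(u)| ≤ ⌈#box₀ · 𝔅⁴E(2)⌉`. [folklore] -/
theorem siegel_of_hyp (hMcl : P.Mcl = S.G) :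
    S.Siegel (h := P.hparℓ) (Lb := P.Lbℓ) P.J₀ℓ P.Lℓ P.Lθℓ P.S₀ℓ P.Tℓ
      ⌈((S.toQ.flat.box (h := P.hparℓ) (Lb := P.Lbℓ) P.Lℓ P.Lθℓ 0).card : ℝ) * (P.𝔅ℓ ^ 4 * P.Efacℓ 2)⌉ := by
  classical
  have hS₀ : 1 ≤ P.S₀ℓ := le_trans (by norm_num) P.two_le_S₀
  have hAmax : 1 ≤ P.𝔅ℓ ^ 4 * P.Efacℓ 2 :=
    one_le_mul_of_one_le_of_one_le (one_le_pow₀ P.one_le_𝔅) (P.one_le_Efacp (by norm_num))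
  have hA : ∀ s, s < P.S₀ℓ → ∀ τ : Tau S.d, tauNorm τ < P.Tℓ →
      ∀ u ∈ S.toQ.flat.box (h := P.hparℓ) (Lb := P.Lbℓ) P.Lℓ P.Lθℓ 0,
      |((S.toQ.flat.Dclear (h := P.hparℓ) P.J₀ℓ P.Lℓ P.Lθℓ s τ : ℕ) : ℝ) * (S.toQ.qTerm P.J₀ℓ 0 u τ s : ℝ)| ≤
        P.𝔅ℓ ^ 4 * P.Efacℓ 2 := by
    intro s hs τ hτ u hu
    rw [abs_mul, S.abs_cast_qTerm_eq_flat, ← abs_mul]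
    have := hy.abs_Dclear_qTerm_le_pℓ hs hτ hu
    unfold PadicW80ParL.Efacℓ; exact this
  -- the count with the class price: `2·G·#((range S₀) ×ˢ tauSet) ≤ #box₀`
  have hcount : 2 * S.G * ((range P.S₀ℓ) ×ˢ tauSet S.d P.Tℓ).card ≤
      (S.toQ.flat.box (h := P.hparℓ) (Lb := P.Lbℓ) P.Lℓ P.Lθℓ 0).card := by
    have hreal := PadicW80ParL.padic_siegel_count_real S.toQ.flat P
    rw [hMcl] at hreal
    rw [S.toQ.flat.card_box, card_product, card_range]
    simp only [pow_zero, Nat.div_one]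
    have hprodL : (∏ j, (P.Lℓ j + 1)) * (P.Lθℓ + 1) = ∏ i, (P.Lallℓ i + 1) := by
      rw [Fin.prod_univ_castSucc]
      simp only [PadicW80ParL.Lall_castSucc, PadicW80ParL.Lall_last]
    have key : ((2 * S.G * (P.S₀ℓ * (tauSet S.d P.Tℓ).card) : ℕ) : ℝ) ≤
        ((P.hparℓ * P.Lbℓ * ((∏ j, (P.Lℓ j + 1)) * (P.Lθℓ + 1)) : ℕ) : ℝ) := by
      rw [hprodL]; push_cast; linarith
    exact_mod_cast key
  exact S.siegel_class P.J₀ℓ P.Lℓ P.Lθℓ P.S₀ℓ P.Tℓ hS₀ P.one_le_T hcount hAmax hA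

omit hy in
/-- **The endgame at the record** (`endgame_of_numbers` with p1's `endgame_numbers` and
`Lθ_lt_two_pow`). [folklore] -/
theorem endgame_of_params (Pint : ℤ) (P : PadicW80ParL S.d) :
    S.Endgame (h := P.hparℓ) (Lb := P.Lbℓ) P.J₀ℓ P.Lℓ P.Lθℓ P.S₀ℓ P.Tℓ Pint := by
  obtain ⟨h1, h2⟩ := P.endgame_numbers
  have hT' : (P.Tℓ / 2 ^ P.J₀ℓ - ∑ j, P.Lℓ j / 2 ^ P.J₀ℓ) + ∑ j, P.Lℓ j / 2 ^ P.J₀ℓ ≤ P.Tℓ / 2 ^ P.J₀ℓ := by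
    omega
  exact S.endgame_of_numbers (T' := P.Tℓ / 2 ^ P.J₀ℓ - ∑ j, P.Lℓ j / 2 ^ P.J₀ℓ) h2 P.Lθ_lt_two_pow hT'

/-! ### The integer coefficient bound and the pack -/

omit hy in
/-- The integer coefficient bound of Siegel's step: `⌈#box₀ · 𝔅⁴ E(2)⌉`. [folklore] -/
def PintP (S : TwistSetup p) (P : PadicW80ParL S.d) : ℤ :=
  ⌈((S.toQ.flat.box (h := P.hparℓ) (Lb := P.Lbℓ) P.Lℓ P.Lθℓ 0).card : ℝ) * (P.𝔅ℓ ^ 4 * P.Efacℓ 2)⌉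

omit hy in
/-- `PintP ≤ PrV = 2·𝔅⁵E(2)` (`#box₀ ≤ 𝔅`). [folklore] -/
theorem PintP_le_PrV (S : TwistSetup p) (P : PadicW80ParL S.d) : (S.PintP P : ℝ) ≤ P.PrVℓ := by
  classical
  unfold PintP PadicW80ParL.PrVℓ
  have hcard : ((S.toQ.flat.box (h := P.hparℓ) (Lb := P.Lbℓ) P.Lℓ P.Lθℓ 0).card : ℝ) ≤ P.𝔅ℓ :=
    S.toQ.flat.card_box_le_𝔅_pℓ P 0
  have hE := P.Efacp_pos 2
  have hA0 : 0 ≤ P.𝔅ℓ ^ 4 * P.Efacℓ 2 := by have := P.𝔅_pos; positivity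
  have hA1 : 1 ≤ P.𝔅ℓ ^ 5 * P.Efacℓ 2 :=
    one_le_mul_of_one_le_of_one_le (one_le_pow₀ P.one_le_𝔅) (P.one_le_Efacp (by norm_num))
  have h1 : ((S.toQ.flat.box (h := P.hparℓ) (Lb := P.Lbℓ) P.Lℓ P.Lθℓ 0).card : ℝ) * (P.𝔅ℓ ^ 4 * P.Efacℓ 2) ≤
      P.𝔅ℓ ^ 5 * P.Efacℓ 2 := by
    calc ((S.toQ.flat.box (h := P.hparℓ) (Lb := P.Lbℓ) P.Lℓ P.Lθℓ 0).card : ℝ) * (P.𝔅ℓ ^ 4 * P.Efacℓ 2)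
        ≤ P.𝔅ℓ * (P.𝔅ℓ ^ 4 * P.Efacℓ 2) := mul_le_mul_of_nonneg_right hcard hA0
      _ = P.𝔅ℓ ^ 5 * P.Efacℓ 2 := by ring
  have h2 := Int.ceil_lt_add_one (((S.toQ.flat.box (h := P.hparℓ) (Lb := P.Lbℓ) P.Lℓ P.Lθℓ 0).card : ℝ) *
    (P.𝔅ℓ ^ 4 * P.Efacℓ 2))
  linarith

/-- **The parameter pack of the twisted machine at p1's record**, every input of `TwistSetup.main`
discharged from the height link, the signed Kummer condition, `ℓ = log p`, the class price `Mcl = G`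
and the oddness of `G`. [folklore] -/
def paramPackOf (hind : ∀ T' : Finset (Fin (S.d + 1)), T'.Nonempty → ¬ IsSquare (∏ i ∈ T', S.toQ.all i))
    (hℓp : P.ℓ = Real.log p) (hMcl : P.Mcl = S.G) (hodd : Odd S.G) : S.ParamPack P.Uℓ where
  h := P.hparℓ
  Lb := P.Lbℓ
  J₀ := P.J₀ℓ
  L := P.Lℓ
  Lθ := P.Lθℓ
  S₀ := P.S₀ℓ
  T := P.Tℓ
  P := S.PintP P
  t := P.tJℓ
  Dmax := fun _ k => P.DmaxKℓ k
  Mmax := fun _ k => P.MmaxKℓ k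
  hS₀ := P.even_S₀
  ht := fun _ hJ => P.one_le_tJ hJ
  htT := fun J _ => by have := P.tJ_mul_le J; nlinarith
  hUp := by rw [← hℓp]; exact P.ℓ_le_U
  hsz := fun J hJ pv inv => kSizes_of_hyp hy (P.tJℓ J) (S.PintP_le_PrV P) hJ inv
  hfin := fun hΛ J hJ =>
    S.kFinal_of_log_ineq J P.S₀ℓ (P.tJℓ J) (fun k => P.DmaxKℓ k) (fun k => P.MmaxKℓ k) hΛ
      (fun k _ => ⟨P.DmaxK_pos k, P.MmaxK_pos k⟩)
      (fun k hk => P.kstep_ineq_one S.hp3 hℓp hJ hk (P.logDM_le_budget k))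
      (fun k hk => P.kstep_ineq_two S.hp3 hℓp hJ hk (P.logDM_le_budget k))
  hhalf := fun hΛ J hJ => by
    have hp0 : (0 : ℝ) < p := by exact_mod_cast (Fact.out : p.Prime).pos
    have hΛ' : ‖S.Λ₀‖ ≤ (p : ℝ)⁻¹ := by
      refine hΛ.trans ?_
      rw [← Real.exp_log hp0, ← Real.exp_neg, Real.exp_le_exp, ← hℓp]
      exact neg_le_neg P.ℓ_le_U
    have hroom : P.Tℓ / 2 ^ (J + 1) + P.tJℓ J ≤ P.Tℓ / 2 ^ J - S.d * P.tJℓ J := by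
      have h2 := P.room_half J
      have e1 : (S.d + 1) * P.tJℓ J = S.d * P.tJℓ J + P.tJℓ J := by ring
      rw [e1] at h2
      omega
    have hH1 : 1 ≤ heightProd S.toQ.all := CW77.one_le_heightProd _
    have hH : heightProd S.toQ.all ≤ Real.exp ((∑ j, P.V j) + P.Vθ) := by
      have h1 := hy.heightProd_le
      rw [S.toQ.heightProd_flat_all, CW77.Setup.SizeHyp.sum_snoc] at h1
      exact h1
    refine S.halfStep_of hodd hJ hind hΛ' (P.one_le_tJ hJ) hroom
      (hSizesHalf_of_hyp hy (S.PintP_le_PrV P) hJ) ?_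
    exact S.hFinalHalf_of_log_ineq J P.S₀ℓ (P.tJℓ J) hΛ (by linarith [P.one_le_DmaxHp])
      (by linarith [P.one_le_MmaxHp])
      (P.halfstep_ineq_one S.hp3 hℓp hJ (P.bhalf_le_budget hH1 hH))
      (P.halfstep_ineq_two S.hp3 hℓp hJ (P.bhalf_le_budget hH1 hH))
  hsiegel := siegel_of_hyp hy hMcl
  hend := endgame_of_params _ P

/-- **`‖Λ₀‖_p > e^{−U}` at p1's record** — all inputs of the twisted descent discharged. [folklore] -/
theorem norm_Λ₀_gt (hind : ∀ T' : Finset (Fin (S.d + 1)), T'.Nonempty → ¬ IsSquare (∏ i ∈ T', S.toQ.all i))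
    (hℓp : P.ℓ = Real.log p) (hMcl : P.Mcl = S.G) (hodd : Odd S.G) : Real.exp (-P.Uℓ) < ‖S.Λ₀‖ :=
  not_le.mp (S.not_norm_Λ₀_le_of_paramPack (paramPackOf hy hind hℓp hMcl hodd))

end TwistSetup

end Summit.ABC.StewartYu

end
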